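import Literature.NumberTheory.LFunctions.WeilMarkovQuadratic
import HarnessLib

/-!
# Connes–Consani 2019, "The Riemann–Roch strategy" §3.1 — the quadratic form `𝔰(f,f) = N(f ⋆ f̃)`,
the degree / codegree of the divisor `D(f)`, the criterion (15), and its dictionary to Weil's
explicit formula (STATEMENT LAYER + PROVED NORMALISATION)

Source: A. Connes, C. Consani, *The Riemann–Roch strategy, Complex lift of the Scaling Site*,
in: Advances in Noncommutative Geometry, Springer 2019 (= arXiv:1805.10501), §3.1, eqs. (15)–(17)
[bib: `ConnesConsani2019RiemannRochStrategy`]; the same objects in A. Connes, *An essay on the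
Riemann Hypothesis* (2016), §3.1 eqs. (17)–(18) and §4.1 [bib: `Connes2016EssayRH`].  The criterion
(15) is attributed there to E. Bombieri [bib: `Bombieri2000Weil`].

Cell `pub-rhdoor` (motivic door), seat cc-3 (the inequality).  HONEST FRAMING: this file types the
ANALYTIC objects of CC 2019 §3.1 verbatim (multiplicative variable `u ∈ ℝ₊^*`, `d^*u = du/u`) and
PROVES their dictionary to the tree's additive normalisation
(`Literature/NumberTheory/LFunctions/WeilExplicit.lean`, `t = log u`, Bombieri's `x = e^t`):

* `ccN` — the distribution `N` of eq. (16), `N(h) = Σ Λ(n) h(n) + ∫₁^∞ (u² h(u) − h(1))/(u² − 1) d^*u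
  + c h(1)`, `c = ½ (log π + γ)`;
* `mulConv`, `mulReflect` — the convolution `⋆` on `ℝ₊^*` and `g̃(u) = u⁻¹ g(u⁻¹)`; `ccPairing f g =
  N(f ⋆ g̃)` — the form `𝔰(f,g)` of eq. (15)/(17);
* `massDstar f = ∫ f d^*u`, `massDu f = ∫ f du` — the two linear forms of (15) ("degree and codegree
  of `D = ∫ f(λ) Ψ_λ d^*λ`", p. 10);
* `toMul u` — the transport `f(x) = x^{-1/2} u(log x)` of an additive test function `u`
  (`weilMellin` docstring: "`ĝ` is the Mellin transform of `x ↦ x^{-1/2} g(log x)`");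
* `Criterion` — the right-hand side of (15) over CC's test class (real, smooth, compactly supported on
  `ℝ₊^*`, parametrised as `toMul u`, `u ∈ C_c^∞(ℝ)` real), and the NAMED FACT `eq15 : RH ↔ Criterion`
  (discharged summit-side from the tree's `riemannHypothesis_iff_poleFree`; not re-proved here).

PROVED here (no facts used): for every test function `g` and `k = g ⋆ g̃`, `κ = Re k`,
`2 · ccN (toMul κ) = Re (weilPrimeTerm k) − Re (weilArchTerm k) = weilPoleForm g − Re (weilQuadratic g)`
(`two_mul_ccN_toMul_eq`, `two_mul_ccN_toMul_eq_weilPoleForm_sub`): the prime sums agree because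
`k(−t) = conj k(t)`; the archimedean parts agree after `u = e^t`, the two integrands differing by
`2κ(0)/(e^t + 1)`, whose integral `2κ(0) log 2` converts `c = ½(log π + γ)` into Bombieri's
`½(log 4π + γ)`; and for real `u`, `(toMul u) ⋆ (toMul u)~ = toMul κ` on `ℝ₊^*`
(`mulConv_toMul_mulReflect_toMul`), `ĝ(0) = ∫ f d^*u`, `ĝ(1) = ∫ f du` (`weilMellin_zero_eq_massDstar`,
`weilMellin_one_eq_massDu`).  Hence `𝔰(f,f) = ½ (weilPoleForm g − Re Q(g))` exactly — the cell's
NORMALISATION.md §1 row 4, previously DATA (two engines), is a theorem.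

What is NOT here: the divisors `D(f) = ∫ f(λ)Ψ_λ d^*λ`, the intersection pairing `D • D'` and the
Riemann–Roch problem on the square of the Scaling Site (eq. (17) and the "key missing step", p. 10) —
none of these is defined in print beyond the decree `D • D := 𝔰(f,f)` (cell file `LOCATED-GAP.md`
§cc-3); nothing in this file is an RH statement.
-/

noncomputable section

open Complex Filter Set MeasureTheory
open scoped Real Topology ComplexConjugate ArithmeticFunction.vonMangoldt

namespace Literature.NumberTheory.ConnesConsani2019

open Literature.NumberTheory.LFunctions

/-! ## The objects of §3.1, verbatim in the variable `u ∈ ℝ₊^*` -/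

/-- The distribution `N` of CC 2019 eq. (16) paired with a test function `h` on `ℝ₊^*`:
`N(h) := Σ_{n ≥ 1} Λ(n) h(n) + ∫₁^∞ (u² h(u) − h(1)) / (u² − 1) d^*u + c · h(1)`,
`c = ½ (log π + γ)`, `d^*u = du / u`.  (`h` is a function on `ℝ`; only its values on `(0, ∞)` enter,
`ccN_congr`.) [cite: ConnesConsani2019RiemannRochStrategy, §3.1 eq. (16) p. 10] -/
def ccN (h : ℝ → ℝ) : ℝ :=
  (∑' n : ℕ, Λ n * h n) +
    (∫ u in Ioi (1 : ℝ), (u ^ 2 * h u - h 1) / (u ^ 2 - 1) / u) +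
    (Real.log π + Real.eulerMascheroniConstant) / 2 * h 1

/-- `g̃(u) := u⁻¹ g(u⁻¹)` (CC 2019, line after (15)). [cite: ConnesConsani2019RiemannRochStrategy, §3.1 p. 10] -/
def mulReflect (f : ℝ → ℝ) : ℝ → ℝ := fun u ↦ u⁻¹ * f u⁻¹

/-- The convolution product on the multiplicative group `ℝ₊^*` with its Haar measure `d^*v = dv/v`:
`(f₁ ⋆ f₂)(u) = ∫₀^∞ f₁(v) f₂(u/v) d^*v`. [cite: ConnesConsani2019RiemannRochStrategy, §3.1 p. 10] -/
def mulConv (f₁ f₂ : ℝ → ℝ) : ℝ → ℝ := fun u ↦ ∫ v in Ioi (0 : ℝ), f₁ v * f₂ (u / v) / v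

/-- The form `𝔰(f, g) := N(f ⋆ g̃)` of CC 2019 (15)–(17) (Essay 2016 eq. (17)).
[cite: ConnesConsani2019RiemannRochStrategy, §3.1 eq. (15)–(17) p. 10] -/
def ccPairing (f₁ f₂ : ℝ → ℝ) : ℝ := ccN (mulConv f₁ (mulReflect f₂))

/-- `∫ f(u) d^*u` — the first linear form in (15) (with `∫ f du`, "the degree and codegree of
`D = ∫ f(λ)Ψ_λ d^*λ`", p. 10). [cite: ConnesConsani2019RiemannRochStrategy, §3.1 eq. (15) p. 10] -/
def massDstar (f : ℝ → ℝ) : ℝ := ∫ u in Ioi (0 : ℝ), f u / u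

/-- `∫ f(u) du` — the second linear form in (15). [cite: ConnesConsani2019RiemannRochStrategy, §3.1 eq. (15) p. 10] -/
def massDu (f : ℝ → ℝ) : ℝ := ∫ u in Ioi (0 : ℝ), f u

/-- The transport of an additive test function `u` (variable `t = log x`) to CC's multiplicative
variable: `f(x) = x^{-1/2} u(log x)` (Bombieri 2000 §2, `x = e^t`; the tree's `weilMellin` is the Mellin
transform of exactly this `f`). Values at `x ≤ 0` are junk and never used. [folklore] -/
def toMul (u : ℝ → ℝ) : ℝ → ℝ := fun x ↦ x ^ (-(1 / 2 : ℝ)) * u (Real.log x)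

/-- The right-hand side of CC 2019 (15): `𝔰(f,f) ≤ 0` for every real test function `f` on `ℝ₊^*` with
`∫ f d^*u = ∫ f du = 0`; CC's test class (real, smooth, compactly supported in `ℝ₊^*`) is parametrised
as `f = toMul u`, `u : ℝ → ℝ` smooth of compact support. [cite: ConnesConsani2019RiemannRochStrategy, §3.1 eq. (15) p. 10] -/
def Criterion : Prop :=
  ∀ u : ℝ → ℝ, IsWeilTest (fun t ↦ (u t : ℂ)) →
    massDstar (toMul u) = 0 → massDu (toMul u) = 0 → ccPairing (toMul u) (toMul u) ≤ 0

/-- NAMED FACT, CC 2019 eq. (15) ("It is known ([B3]) that…", Bombieri's form of Weil's criterion):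
`RH ⟺ 𝔰(f,f) ≤ 0 ∀ f | ∫ f d^*u = ∫ f du = 0`.  Discharged summit-side
(`Summits/RiemannHypothesis/…/Theorems/MotivicDoorCC2019Criterion.lean`) from
`riemannHypothesis_iff_poleFree` and the normalisation theorems below; users take `(h : eq15)`.
[cite: ConnesConsani2019RiemannRochStrategy, §3.1 eq. (15) p. 10] -/
def eq15 : Prop := RiemannHypothesis ↔ Criterion

/-! ## Elementary rewriting lemmas -/

/-- `N(h)` only depends on `h` on `(0, ∞)`. [folklore] -/
theorem ccN_congr {h₁ h₂ : ℝ → ℝ} (heq : ∀ u, 0 < u → h₁ u = h₂ u) : ccN h₁ = ccN h₂ := by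
  unfold ccN
  have h1 : h₁ 1 = h₂ 1 := heq 1 one_pos
  have hs : (fun n : ℕ ↦ Λ n * h₁ n) = fun n : ℕ ↦ Λ n * h₂ n := by
    funext n
    rcases Nat.eq_zero_or_pos n with rfl | hn
    · simp
    · rw [heq n (by exact_mod_cast hn)]
  have hi : ∫ u in Ioi (1 : ℝ), (u ^ 2 * h₁ u - h₁ 1) / (u ^ 2 - 1) / u =
      ∫ u in Ioi (1 : ℝ), (u ^ 2 * h₂ u - h₂ 1) / (u ^ 2 - 1) / u := by
    refine setIntegral_congr_fun measurableSet_Ioi fun u hu ↦ ?_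
    rw [heq u (zero_lt_one.trans hu), h1]
  rw [hs, hi, h1]

/-- `toMul u 1 = u 0`. [folklore] -/
@[simp] theorem toMul_one (u : ℝ → ℝ) : toMul u 1 = u 0 := by simp [toMul]

/-- `toMul u (e^t) = e^{-t/2} u(t)`. [folklore] -/
theorem toMul_exp (u : ℝ → ℝ) (t : ℝ) : toMul u (Real.exp t) = Real.exp (-(t / 2)) * u t := by
  simp only [toMul, Real.log_exp]
  rw [← Real.exp_mul]
  ring_nf

/-- `toMul u n = n^{-1/2} u(log n) = u(log n) / √n` for `n ≥ 1`. [folklore] -/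
theorem toMul_natCast (u : ℝ → ℝ) {n : ℕ} (hn : 0 < n) :
    toMul u n = u (Real.log n) / Real.sqrt n := by
  simp only [toMul]
  rw [Real.rpow_neg (Nat.cast_nonneg n), ← Real.sqrt_eq_rpow]
  have : 0 < Real.sqrt n := Real.sqrt_pos.2 (by exact_mod_cast hn)
  field_simp

/-- `(toMul u)~ = toMul (u ∘ neg)` on `(0, ∞)`: `w⁻¹ (w⁻¹)^{-1/2} u(log w⁻¹) = w^{-1/2} u(−log w)`. [folklore] -/
theorem mulReflect_toMul (u : ℝ → ℝ) {w : ℝ} (hw : 0 < w) :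
    mulReflect (toMul u) w = toMul (fun s ↦ u (-s)) w := by
  simp only [mulReflect, toMul, Real.log_inv]
  have h1 : (w⁻¹) ^ (-(1 / 2 : ℝ)) = w ^ (1 / 2 : ℝ) := by
    rw [Real.inv_rpow hw.le, Real.rpow_neg hw.le, inv_inv]
  have h2 : w⁻¹ * w ^ (1 / 2 : ℝ) = w ^ (-(1 / 2 : ℝ)) := by
    rw [← Real.rpow_neg_one, ← Real.rpow_add hw]
    norm_num
  rw [h1, ← mul_assoc, h2]

/-! ## Change of variables `u = e^t` (no integrability needed: Mathlib's Jacobian formula) -/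

/-- `∫_{(0,∞)} G(v) dv = ∫_ℝ e^t G(e^t) dt` for every `G`. [folklore] -/
theorem setIntegral_Ioi_zero_eq_integral_exp (G : ℝ → ℝ) :
    ∫ v in Ioi (0 : ℝ), G v = ∫ t : ℝ, Real.exp t * G (Real.exp t) := by
  have h := integral_image_eq_integral_abs_deriv_smul (f := Real.exp) (f' := Real.exp)
    (s := univ) MeasurableSet.univ (fun t _ ↦ (Real.hasDerivAt_exp t).hasDerivWithinAt)
    Real.exp_injective.injOn G
  rw [image_univ, Real.range_exp, Measure.restrict_univ] at h
  rw [h]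
  refine integral_congr_ae (Eventually.of_forall fun t ↦ ?_)
  simp [abs_of_pos (Real.exp_pos t)]

/-- `∫_{(1,∞)} G(v) dv = ∫_{(0,∞)} e^t G(e^t) dt` for every `G`. [folklore] -/
theorem setIntegral_Ioi_one_eq_setIntegral_exp (G : ℝ → ℝ) :
    ∫ v in Ioi (1 : ℝ), G v = ∫ t in Ioi (0 : ℝ), Real.exp t * G (Real.exp t) := by
  have h := integral_image_eq_integral_abs_deriv_smul (f := Real.exp) (f' := Real.exp)
    (s := Ioi 0) measurableSet_Ioi (fun t _ ↦ (Real.hasDerivAt_exp t).hasDerivWithinAt)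
    Real.exp_injective.injOn G
  rw [Real.image_exp_Ioi, Real.exp_zero] at h
  rw [h]
  refine setIntegral_congr_fun measurableSet_Ioi fun t _ ↦ ?_
  simp [abs_of_pos (Real.exp_pos t)]

/-! ## The transport of the convolution and of the two linear forms (real `u`) -/

/-- For real `u`: `Re (u ⋆ ũ)(v) = ∫ u(s) u(s − v) ds`. [folklore] -/
theorem re_weilConv_ofReal (u : ℝ → ℝ) (v : ℝ) :
    (weilConv (fun s ↦ (u s : ℂ)) (weilReflect fun s ↦ (u s : ℂ)) v).re = ∫ s, u s * u (s - v) := by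
  rw [weilConv_apply, ← Complex.ofReal_re (∫ s, u s * u (s - v)), ← integral_complex_ofReal]
  congr 2 with s
  simp only [weilReflect, Complex.conj_ofReal, neg_sub]
  push_cast
  ring

/-- **`(toMul u) ⋆ (toMul u)~ = toMul κ` on `ℝ₊^*`**, `κ(t) = Re (g ⋆ g̃)(t) = ∫ u(s) u(s − t) ds`,
`g = u` viewed in `ℂ`. [folklore] -/
theorem mulConv_toMul_mulReflect_toMul (u : ℝ → ℝ) {x : ℝ} (hx : 0 < x) :
    mulConv (toMul u) (mulReflect (toMul u)) x =
      toMul (fun t ↦ (weilConv (fun s ↦ (u s : ℂ)) (weilReflect fun s ↦ (u s : ℂ)) t).re) x := by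
  simp only [mulConv]
  rw [setIntegral_Ioi_zero_eq_integral_exp]
  have hpt : ∀ t : ℝ, Real.exp t * (toMul u (Real.exp t) * mulReflect (toMul u) (x / Real.exp t) /
      Real.exp t) = x ^ (-(1 / 2 : ℝ)) * (u t * u (t - Real.log x)) := by
    intro t
    have he : 0 < Real.exp t := Real.exp_pos t
    have hq : 0 < x / Real.exp t := div_pos hx he
    rw [mulReflect_toMul u hq]
    simp only [toMul]
    rw [Real.log_exp, Real.log_div hx.ne' he.ne', Real.log_exp, Real.div_rpow hx.le he.le, neg_sub]
    have hne : Real.exp t ^ (-(1 / 2 : ℝ)) ≠ 0 := (Real.rpow_pos_of_pos he _).ne'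
    have hne' : Real.exp t ≠ 0 := he.ne'
    field_simp
  simp_rw [hpt, integral_const_mul]
  simp only [toMul, re_weilConv_ofReal]

/-- `ĝ(0) = ∫ f d^*u` for `f = toMul u`, `g = u`: `∫₀^∞ x^{-1/2} u(log x) dx/x = ∫ u(t) e^{-t/2} dt`. [folklore] -/
theorem weilMellin_zero_eq_massDstar (u : ℝ → ℝ) :
    weilMellin (fun t ↦ (u t : ℂ)) 0 = ((massDstar (toMul u) : ℝ) : ℂ) := by
  simp only [massDstar, weilMellin]
  rw [setIntegral_Ioi_zero_eq_integral_exp, ← integral_complex_ofReal]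
  refine integral_congr_ae (Eventually.of_forall fun t ↦ ?_)
  dsimp only
  have he : Real.exp t ≠ 0 := (Real.exp_pos t).ne'
  rw [toMul_exp]
  have hexp : cexp ((0 - 1 / 2) * (t : ℂ)) = ((Real.exp (-(t / 2)) : ℝ) : ℂ) := by
    rw [Complex.ofReal_exp]; congr 1; push_cast; ring
  rw [hexp, ← Complex.ofReal_mul]
  congr 1
  field_simp

/-- `ĝ(1) = ∫ f du` for `f = toMul u`, `g = u`: `∫₀^∞ x^{-1/2} u(log x) dx = ∫ u(t) e^{t/2} dt`. [folklore] -/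
theorem weilMellin_one_eq_massDu (u : ℝ → ℝ) :
    weilMellin (fun t ↦ (u t : ℂ)) 1 = ((massDu (toMul u) : ℝ) : ℂ) := by
  simp only [massDu, weilMellin]
  rw [setIntegral_Ioi_zero_eq_integral_exp, ← integral_complex_ofReal]
  refine integral_congr_ae (Eventually.of_forall fun t ↦ ?_)
  dsimp only
  rw [toMul_exp]
  have hexp : cexp ((1 - 1 / 2) * (t : ℂ)) = (((Real.exp (t / 2)) : ℝ) : ℂ) := by
    rw [Complex.ofReal_exp]; congr 1; push_cast; ring
  rw [hexp, ← Complex.ofReal_mul]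
  congr 1
  rw [← mul_assoc, ← Real.exp_add, show t + -(t / 2) = t / 2 by ring]
  ring

/-! ## The prime term -/

variable {g : ℝ → ℂ}

/-- **Prime parts agree**: `Re Σ Λ(n) n^{-1/2} (k(log n) + k(−log n)) = 2 Σ Λ(n) (toMul κ)(n)`,
`κ = Re k`, because `k(−t) = conj k(t)` for `k = g ⋆ g̃`. [folklore] -/
theorem re_weilPrimeTerm_eq_two_mul_tsum (hg : IsWeilTest g) :
    (weilPrimeTerm (weilConv g (weilReflect g))).re =
      2 * ∑' n : ℕ, Λ n * toMul (fun t ↦ (weilConv g (weilReflect g) t).re) n := by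
  set k := weilConv g (weilReflect g) with hkdef
  have hk : IsWeilTest k := hg.weilConv hg.weilReflect
  have hs := summable_weilPrimeTerm (g := k) hk.2
  rw [weilPrimeTerm, Complex.re_tsum hs, ← tsum_mul_left]
  refine tsum_congr fun n ↦ ?_
  rcases Nat.eq_zero_or_pos n with rfl | hn
  · simp
  have hre : (k (-Real.log n)).re = (k (Real.log n)).re := by
    rw [hkdef, weilConv_weilReflect_neg, Complex.conj_re]
  have h1 : ((Λ n : ℝ) : ℂ) / (Real.sqrt n : ℂ) = (((Λ n) / Real.sqrt n : ℝ) : ℂ) := by push_cast; rfl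
  rw [h1, Complex.re_ofReal_mul, Complex.add_re, hre, toMul_natCast _ hn]
  ring

/-! ## The archimedean term -/

/-- `k(0)` is real and `k(t) + k(−t) = 2 Re k(t)` for `k = g ⋆ g̃`, so Bombieri's integrand is the real
function `(e^{t/2} · 2κ(t) − 2κ(0)) / (2 sinh t)`. [folklore] -/
theorem bombieriIntegrand_eq_ofReal (g : ℝ → ℂ) (t : ℝ) :
    ((Real.exp (t / 2) : ℂ) * (weilConv g (weilReflect g) t + weilConv g (weilReflect g) (-t)) -
        2 * weilConv g (weilReflect g) 0) / (2 * Real.sinh t : ℂ) =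
      (((Real.exp (t / 2) * (2 * (weilConv g (weilReflect g) t).re) -
        2 * (weilConv g (weilReflect g) 0).re) / (2 * Real.sinh t) : ℝ) : ℂ) := by
  have hsum : weilConv g (weilReflect g) t + weilConv g (weilReflect g) (-t) =
      ((2 * (weilConv g (weilReflect g) t).re : ℝ) : ℂ) := by
    rw [weilConv_weilReflect_neg, Complex.add_conj]
  have h0 : weilConv g (weilReflect g) 0 = (((weilConv g (weilReflect g) 0).re : ℝ) : ℂ) := by
    have h := weilConv_weilReflect_neg g 0
    rw [neg_zero] at h
    exact (Complex.conj_eq_iff_re.1 h.symm).symm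
  have h0' : ((2 * (weilConv g (weilReflect g) 0).re : ℝ) : ℂ) = 2 * weilConv g (weilReflect g) 0 := by
    push_cast; rw [← h0]
  rw [hsum, ← h0']
  simp only [Complex.ofReal_div, Complex.ofReal_sub, Complex.ofReal_mul, Complex.ofReal_ofNat]

/-- `−Re W_∞^{Bombieri}(k) = (log 4π + γ) κ(0) + ∫₀^∞ (e^{t/2} 2κ(t) − 2κ(0))/(2 sinh t) dt`. [folklore] -/
theorem neg_re_weilArchTermBombieri_eq (g : ℝ → ℂ) :
    -(weilArchTermBombieri (weilConv g (weilReflect g))).re =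
      (Real.log (4 * π) + Real.eulerMascheroniConstant) * (weilConv g (weilReflect g) 0).re +
        ∫ t in Ioi (0 : ℝ), (Real.exp (t / 2) * (2 * (weilConv g (weilReflect g) t).re) -
          2 * (weilConv g (weilReflect g) 0).re) / (2 * Real.sinh t) := by
  rw [weilArchTermBombieri_eq]
  simp_rw [bombieriIntegrand_eq_ofReal g]
  rw [integral_complex_ofReal]
  have h0 : (weilConv g (weilReflect g) 0) = ((((weilConv g (weilReflect g) 0).re : ℝ)) : ℂ) := by
    have h := weilConv_weilReflect_neg g 0
    rw [neg_zero] at h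
    exact (Complex.conj_eq_iff_re.1 h.symm).symm
  rw [h0]
  simp only [Complex.sub_re, Complex.neg_re, Complex.mul_re, Complex.ofReal_re, Complex.ofReal_im,
    mul_zero, sub_zero, Complex.add_re, Complex.ofReal_re]
  simp
  ring

/-- `∫₀^∞ dt/(e^t + 1) = log 2` (antiderivative `−log(1 + e^{−t})`). [folklore] -/
theorem integral_Ioi_one_div_exp_add_one :
    ∫ t in Ioi (0 : ℝ), 1 / (Real.exp t + 1) = Real.log 2 := by
  have hderiv : ∀ t ∈ Ici (0 : ℝ), HasDerivAt (fun t ↦ -Real.log (1 + Real.exp (-t)))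
      (1 / (Real.exp t + 1)) t := by
    intro t _
    have h1 : HasDerivAt (fun t ↦ 1 + Real.exp (-t)) (Real.exp (-t) * (-1)) t := by
      simpa using ((hasDerivAt_neg t).exp).const_add 1
    have hpos : 1 + Real.exp (-t) ≠ 0 := by positivity
    have h2 := (h1.log hpos).neg
    have h3 : -(Real.exp (-t) * -1 / (1 + Real.exp (-t))) = 1 / (Real.exp t + 1) := by
      rw [Real.exp_neg]
      have hA : Real.exp t + 1 ≠ 0 := by positivity
      have hB : Real.exp t ≠ 0 := (Real.exp_pos t).ne'
      field_simp
    rw [h3] at h2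
    exact h2
  have hpos : ∀ t ∈ Ioi (0 : ℝ), 0 ≤ 1 / (Real.exp t + 1) := fun t _ ↦ by positivity
  have hlim : Tendsto (fun t ↦ -Real.log (1 + Real.exp (-t))) atTop (𝓝 0) := by
    have h := Real.tendsto_exp_neg_atTop_nhds_zero
    have h2 : Tendsto (fun t ↦ 1 + Real.exp (-t)) atTop (𝓝 (1 + 0)) := h.const_add 1
    have h3 := (h2.log (by norm_num)).neg
    simpa using h3
  rw [integral_Ioi_of_hasDerivAt_of_nonneg' hderiv hpos hlim]
  simp
  norm_num

/-- The transported integrand of `∫₁^∞ (u² h(u) − h(1))/(u² − 1) d^*u`, `h = toMul κ`, against Bombieri's: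
for `t > 0`, `2 · (e^{2t} e^{-t/2} κ(t) − κ(0))/(e^{2t} − 1) = (e^{t/2} 2κ(t) − 2κ(0))/(2 sinh t) + 2κ(0)/(e^t + 1)`.
[folklore] -/
theorem two_mul_ccIntegrand_eq (κ : ℝ → ℝ) {t : ℝ} (ht : 0 < t) :
    2 * (Real.exp t * ((Real.exp t ^ 2 * toMul κ (Real.exp t) - toMul κ 1) / (Real.exp t ^ 2 - 1) /
        Real.exp t)) =
      (Real.exp (t / 2) * (2 * κ t) - 2 * κ 0) / (2 * Real.sinh t) + 2 * κ 0 / (Real.exp t + 1) := by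
  rw [toMul_exp, toMul_one]
  set r := Real.exp (t / 2) with hr
  have hr0 : 0 < r := Real.exp_pos _
  have hr1 : 1 < r := Real.one_lt_exp_iff.2 (by linarith)
  have hE : Real.exp t = r ^ 2 := by rw [hr, sq, ← Real.exp_add]; ring_nf
  have hEm : Real.exp (-(t / 2)) = r⁻¹ := by rw [hr, Real.exp_neg]
  have hsinh : Real.sinh t = (r ^ 2 - (r ^ 2)⁻¹) / 2 := by
    rw [Real.sinh_eq, ← hE, Real.exp_neg]
  rw [hE, hEm, hsinh]
  have hr2 : 1 < r ^ 2 := by nlinarith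
  have hr4 : 1 < (r ^ 2) ^ 2 := by nlinarith
  have h1 : (r ^ 2) ^ 2 - 1 ≠ 0 := by linarith
  have h2 : r ^ 2 + 1 ≠ 0 := by positivity
  have h3 : r ^ 2 - (r ^ 2)⁻¹ ≠ 0 := by
    have : (r ^ 2)⁻¹ < 1 := inv_lt_one_of_one_lt₀ hr2
    linarith
  have h4 : r ^ 4 - 1 ≠ 0 := by nlinarith
  have h5 : r + 1 ≠ 0 := by positivity
  have h6 : r - 1 ≠ 0 := by linarith
  have h7 : r ^ 2 - 1 ≠ 0 := by linarith
  field_simp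
  ring

/-- Integrability of the real Bombieri integrand on `(0, ∞)` (from `integrableOn_bombieriIntegrand`). [folklore] -/
theorem integrableOn_realBombieriIntegrand (hg : IsWeilTest g) :
    IntegrableOn (fun t : ℝ ↦ (Real.exp (t / 2) * (2 * (weilConv g (weilReflect g) t).re) -
        2 * (weilConv g (weilReflect g) 0).re) / (2 * Real.sinh t)) (Ioi 0) := by
  have hk : IsWeilTest (weilConv g (weilReflect g)) := hg.weilConv hg.weilReflect
  have h : IntegrableOn (fun t : ℝ ↦ RCLike.re (((Real.exp (t / 2) : ℂ) *
      (weilConv g (weilReflect g) t + weilConv g (weilReflect g) (-t)) -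
        2 * weilConv g (weilReflect g) 0) / (2 * Real.sinh t : ℂ))) (Ioi 0) :=
    (integrableOn_bombieriIntegrand hk).re
  refine IntegrableOn.congr_fun h (fun t _ ↦ ?_) measurableSet_Ioi
  rw [bombieriIntegrand_eq_ofReal g t, RCLike.re_to_complex, Complex.ofReal_re]

/-- Integrability of `t ↦ c/(e^t + 1)` on `(0, ∞)`. [folklore] -/
theorem integrableOn_const_div_exp_add_one (c : ℝ) :
    IntegrableOn (fun t : ℝ ↦ c / (Real.exp t + 1)) (Ioi 0) := by
  have h1 : IntegrableOn (fun t : ℝ ↦ 1 / (Real.exp t + 1)) (Ioi 0) := by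
    refine Integrable.mono' (exp_neg_integrableOn_Ioi 0 zero_lt_one) ?_ ?_
    · exact (continuous_const.div (Real.continuous_exp.add continuous_const)
        (fun t ↦ (add_pos (Real.exp_pos t) one_pos).ne')).aestronglyMeasurable
    · refine (ae_restrict_mem measurableSet_Ioi).mono fun t _ ↦ ?_
      have hpos : 0 < Real.exp t + 1 := by positivity
      rw [Real.norm_eq_abs, abs_of_nonneg (by positivity), div_le_iff₀ hpos, neg_one_mul]
      have he : Real.exp (-t) * Real.exp t = 1 := by rw [← Real.exp_add]; simp
      nlinarith [Real.exp_pos (-t)]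
  have h2 : IntegrableOn (fun t : ℝ ↦ c * (1 / (Real.exp t + 1))) (Ioi 0) := h1.const_mul c
  refine IntegrableOn.congr_fun h2 (fun t _ ↦ ?_) measurableSet_Ioi
  simp [div_eq_mul_inv]

/-- **Archimedean parts agree**: `−Re W_∞(k) = 2 · (∫₁^∞ (u² h − h(1))/(u² − 1) d^*u + ½(log π + γ) h(1))`,
`h = toMul κ`, `κ = Re k`, `k = g ⋆ g̃`. [folklore] -/
theorem neg_re_weilArchTerm_eq (hg : IsWeilTest g) :
    -(weilArchTerm (weilConv g (weilReflect g))).re =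
      2 * ((∫ u in Ioi (1 : ℝ), (u ^ 2 * toMul (fun t ↦ (weilConv g (weilReflect g) t).re) u -
          toMul (fun t ↦ (weilConv g (weilReflect g) t).re) 1) / (u ^ 2 - 1) / u) +
        (Real.log π + Real.eulerMascheroniConstant) / 2 *
          toMul (fun t ↦ (weilConv g (weilReflect g) t).re) 1) := by
  set κ : ℝ → ℝ := fun t ↦ (weilConv g (weilReflect g) t).re with hκ
  have hk : IsWeilTest (weilConv g (weilReflect g)) := hg.weilConv hg.weilReflect
  rw [← weilArchTermBombieri_eq_weilArchTerm_holds hk, neg_re_weilArchTermBombieri_eq g]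
  rw [setIntegral_Ioi_one_eq_setIntegral_exp, mul_add, ← integral_const_mul]
  have hcongr : ∫ t in Ioi (0 : ℝ), 2 * (Real.exp t * ((Real.exp t ^ 2 * toMul κ (Real.exp t) -
      toMul κ 1) / (Real.exp t ^ 2 - 1) / Real.exp t)) =
      ∫ t in Ioi (0 : ℝ), ((Real.exp (t / 2) * (2 * κ t) - 2 * κ 0) / (2 * Real.sinh t) +
        2 * κ 0 / (Real.exp t + 1)) :=
    setIntegral_congr_fun measurableSet_Ioi fun t ht ↦ two_mul_ccIntegrand_eq κ ht
  rw [hcongr, integral_add (integrableOn_realBombieriIntegrand hg) (integrableOn_const_div_exp_add_one _)]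
  have hlog : ∫ t in Ioi (0 : ℝ), 2 * κ 0 / (Real.exp t + 1) = 2 * κ 0 * Real.log 2 := by
    rw [← integral_Ioi_one_div_exp_add_one, ← integral_const_mul]
    refine setIntegral_congr_fun measurableSet_Ioi fun t _ ↦ ?_
    ring
  rw [hlog, toMul_one]
  have h4 : Real.log (4 * π) = 2 * Real.log 2 + Real.log π := by
    rw [Real.log_mul (by norm_num) Real.pi_ne_zero, show (4 : ℝ) = 2 ^ 2 by norm_num, Real.log_pow]
    ring
  rw [h4]
  ring

/-! ## The dictionary -/

/-- **`2 N(h) = Re (prime term) − Re (archimedean term)`** for `h = toMul (Re k)`, `k = g ⋆ g̃`. [folklore] -/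
theorem two_mul_ccN_toMul_eq (hg : IsWeilTest g) :
    2 * ccN (toMul fun t ↦ (weilConv g (weilReflect g) t).re) =
      (weilPrimeTerm (weilConv g (weilReflect g))).re - (weilArchTerm (weilConv g (weilReflect g))).re := by
  rw [sub_eq_add_neg, neg_re_weilArchTerm_eq hg, re_weilPrimeTerm_eq_two_mul_tsum hg, ccN]
  ring

/-- **The normalisation theorem**: `2 N((toMul Re k)) = P(g) − Re Q(g)`, i.e. CC's `𝔰(f,f) = N(f ⋆ f̃)` is
`½ (weilPoleForm g − Re weilQuadratic g)` once `f ⋆ f̃ = toMul (Re k)` (`mulConv_toMul_mulReflect_toMul`).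
[folklore] -/
theorem two_mul_ccN_toMul_eq_weilPoleForm_sub (hg : IsWeilTest g) :
    2 * ccN (toMul fun t ↦ (weilConv g (weilReflect g) t).re) =
      weilPoleForm g - (weilQuadratic g).re := by
  rw [two_mul_ccN_toMul_eq hg, weilQuadratic, weilFunctional, Complex.add_re, Complex.sub_re,
    weilPolarTerm_weilConv_weilReflect_re hg]
  ring

/-- **CC's pairing in the tree's normalisation** (real `u`, `g = u`, `f = toMul u`):
`2 𝔰(f,f) = weilPoleForm g − Re Q(g)`. [folklore] -/
theorem two_mul_ccPairing_toMul_eq {u : ℝ → ℝ} (hu : IsWeilTest (fun t ↦ (u t : ℂ))) :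
    2 * ccPairing (toMul u) (toMul u) =
      weilPoleForm (fun t ↦ (u t : ℂ)) - (weilQuadratic fun t ↦ (u t : ℂ)).re := by
  rw [ccPairing, ccN_congr (fun x hx ↦ mulConv_toMul_mulReflect_toMul u hx)]
  exact two_mul_ccN_toMul_eq_weilPoleForm_sub hu

end Literature.NumberTheory.ConnesConsani2019
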